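import Literature.Analysis.Matrix.FiniteRangeDecompositionPowGradient
import HarnessLib

/-!
# Finite-range decomposition with smoother pieces, IV: the quasi-one-dimensional regime —
# pointwise domination

`Literature/Analysis/Matrix/`; continues `FiniteRangeDecompositionPowGradient.lean` (the power-`m`
dyadic Fejér decomposition `C^{(m)}_N = frdPiecePow A m N` on an abstract three-dimensional torus:
a finite abelian group `G` with steps `e₀, e₁, e₂` of orders dividing `L₀, L₁, L₂`, a
translation-invariant symmetric `A ≤ 4` with `c₀ Σ_i (2 − 2 Re ψ(e_i)) ≤ σ_A(ψ)`).

There the gradient bounds `|∇^k C^{(m)}_N| ≤ K 2^{−N(k+1)}` are proved for scales BELOW the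
spatial size, `2^N ≤ L_i`.  On an ANISOTROPIC torus `L₀ = L₁ = L ≤ 2^N ≤ L₂ = M` (the space-time torus
`(ℤ/L)² × ℤ/M` with `M ≫ L`) the scales between `L` and `M` are **quasi-one-dimensional**: the
spatial momenta of a character are either zero or at least `1/L ≥ 2^{−N}`, so

* characters with a non-zero spatial momentum lie in the dyadic shells of `|t|_∞` at scale `1/L`,
  where the symbol of the power-`m` piece is suppressed by `(L/2^N)^{2m}`
  (`gradSymbol_frdPiecePow_le_shells_offZero`);
* the spatial zero modes form a one-dimensional family in the temporal momentum `t₂`, on which a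
  difference in a spatial direction VANISHES (`prod_norm_addChar_sub_one_eq_zero_of_spatial`) and a
  purely temporal difference obeys the one-dimensional cube/shell domination at scale `2^{−N}`
  (`gradSymbol_frdPiecePow_le_shells_zeroMode`).

This file proves these POINTWISE dominations (by indicator sums of momentum cubes/shells, as in
part III); the volume averages — `|∇_l C^{(m)}_N(x,y)| ≤ K (L/2^N)^{2m}/L^{k+1}` for lists with a
spatial step and `≤ K 2^{N(1−k)}/L²` for purely temporal lists — are summed in part V
(`FiniteRangeDecompositionQuasi1D.lean`).  Also: the small index lemmas
(`addChar_apply_eq_one_of_index_eq_zero`, `inv_le_abs_addCharMomentum_of_index_ne_zero`).  All [folklore];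
the statements are the `d_eff = 1` rows of the scaling table of [cite: Bauerschmidt2013, (1.10)].
-/

noncomputable section

open Finset Real
open Literature.Analysis.Fourier Literature.Analysis.Fourier.TrigApprox

namespace Literature.Analysis.Matrix

variable {G : Type*} [AddCommGroup G] [Fintype G] [DecidableEq G]

/-! ### Index lemmas: zero momentum and the momentum gap -/

section Index

omit [Fintype G] [DecidableEq G]

/-- A character with index `0` along `g` is trivial on `g`. [folklore] -/
theorem addChar_apply_eq_one_of_index_eq_zero {L : ℕ} (hL : L ≠ 0) {g : G} (hg : L • g = 0)
    (ψ : AddChar G ℂ) (h : addCharIndex L g ψ = 0) : ψ g = 1 := by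
  rw [← (addCharIndex_spec hL hg ψ).1, h]
  simp

/-- Index `0` means momentum `0`. [folklore] -/
theorem addCharMomentum_eq_zero_of_index_eq_zero {L : ℕ} {g : G} (ψ : AddChar G ℂ)
    (h : addCharIndex L g ψ = 0) : addCharMomentum L g ψ = 0 := by
  simp [addCharMomentum, h]

/-- **The momentum gap**: a non-zero index means `|t| ≥ 1/L`. [folklore] -/
theorem inv_le_abs_addCharMomentum_of_index_ne_zero {L : ℕ} (hL : L ≠ 0) {g : G} (ψ : AddChar G ℂ)
    (h : addCharIndex L g ψ ≠ 0) : 1 / (L : ℝ) ≤ |addCharMomentum L g ψ| := by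
  unfold addCharMomentum
  have hLr : (0 : ℝ) < L := Nat.cast_pos.mpr (Nat.pos_of_ne_zero hL)
  rw [abs_div, abs_of_pos hLr, div_le_div_iff_of_pos_right hLr]
  have : (1 : ℤ) ≤ |addCharIndex L g ψ| := Int.one_le_abs h
  have h' : ((1 : ℤ) : ℝ) ≤ ((|addCharIndex L g ψ| : ℤ) : ℝ) := by exact_mod_cast this
  simpa [Int.cast_abs] using h'

end Index

/-! ### Pointwise domination in the quasi-one-dimensional regime -/

section Shells

variable {A : _root_.Matrix G G ℝ}

omit [Fintype G] [DecidableEq G] [AddCommGroup G] in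
/-- `4^N = (2^N)²`. [folklore] -/
private theorem four_pow_eq'' (N : ℕ) : (4 : ℝ) ^ N = (2 ^ N) ^ 2 := by
  rw [show (4 : ℝ) = 2 ^ 2 by norm_num, ← pow_mul, mul_comm, pow_mul]

omit [Fintype G] [DecidableEq G] [AddCommGroup G] in
/-- `4^{Nm} = (2^N)^{2m}`. [folklore] -/
private theorem four_pow_mul_eq' (N m : ℕ) : (4 : ℝ) ^ (N * m) = ((2 : ℝ) ^ N) ^ (2 * m) := by
  rw [pow_mul, four_pow_eq'', ← pow_mul]

/-- **Off the spatial zero modes**: if the index of `ψ` along `e₀` or along `e₁` is non-zero and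
`L₀ = L₁ = L`, then `(Π_{g∈l}‖ψ(g)−1‖)·σ_{C^{(m)}_N}(ψ)` is dominated by the dyadic shells of
`|t|_∞` at scale `1/L`, with the symbol factor `(mπ^{2m+2}/(4·(2^N)^{2m}))·(L²/(16c₀4^j))^{m+1}`.
[folklore] -/
theorem gradSymbol_frdPiecePow_le_shells_offZero
    (e : Fin 3 → G) (Ls : Fin 3 → ℕ) (hL : ∀ i, Ls i ≠ 0) (he : ∀ i, Ls i • e i = 0)
    (hL01 : Ls 1 = Ls 0)
    (hA : IsTranslationInvariant A) (hs : A.IsHermitian) (h0 : A.PosSemidef)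
    (h4 : ((4 : ℝ) • (1 : _root_.Matrix G G ℝ) - A).PosSemidef)
    {c₀ : ℝ} (hc₀ : 0 < c₀)
    (hcoer : ∀ ψ : AddChar G ℂ, c₀ * ∑ i, (2 - 2 * (ψ (e i)).re) ≤ (symbol A ψ).re)
    (m N : ℕ) (ψ : AddChar G ℂ)
    (hψ : addCharIndex (Ls 0) (e 0) ψ ≠ 0 ∨ addCharIndex (Ls 1) (e 1) ψ ≠ 0)
    (l : List G) (hl : ∀ g ∈ l, ∃ i, g = e i ∨ g = -e i) :
    (l.map fun g => ‖ψ g - 1‖).prod * (symbol (frdPiecePow A m N) ψ).re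
      ≤ ∑ j ∈ Finset.range (Nat.log 2 (Ls 0) + 1), (2 * π * 2 ^ (j + 1) / (Ls 0 : ℝ)) ^ l.length
            * (m * π ^ (2 * m + 2) / (4 * ((2 : ℝ) ^ N) ^ (2 * m))
              * (((Ls 0 : ℝ)) ^ 2 / (16 * c₀ * ((2 : ℝ) ^ j) ^ 2)) ^ (m + 1))
            * (if ∀ i, |addCharMomentum (Ls i) (e i) ψ| < 2 ^ (j + 1) / (Ls 0 : ℝ)
                then (1 : ℝ) else 0) := by
  set Lr : ℝ := (Ls 0 : ℝ) with hLr
  have hLpos : 0 < Lr := Nat.cast_pos.mpr (Nat.pos_of_ne_zero (hL 0))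
  set T : ℝ := 2 ^ N with hT
  have hTpos : 0 < T := by positivity
  set t : Fin 3 → ℝ := fun i => addCharMomentum (Ls i) (e i) ψ with ht
  set s := (symbol (frdPiecePow A m N) ψ).re with hsdef
  set a := (symbol A ψ).re with hadef
  set k := l.length with hk
  set P := (l.map fun g => ‖ψ g - 1‖).prod with hPdef
  set Y : ℝ := m * π ^ (2 * m + 2) / (4 * T ^ (2 * m)) with hYdef
  have hY0 : 0 ≤ Y := by rw [hYdef]; positivity
  have hP0 : 0 ≤ P := List.prod_nonneg fun x hx => by
    obtain ⟨g', -, rfl⟩ := List.mem_map.mp hx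
    exact norm_nonneg _
  have hs0 : 0 ≤ s := symbol_frdPiecePow_re_nonneg ψ hA hs h0 h4 m N
  have hsY : s * a ^ (m + 1) ≤ Y := by
    have := symbol_frdPiecePow_re_mul_pow_le ψ hA hs h0 h4 m N
    rwa [four_pow_mul_eq'] at this
  have hB0 : ∀ j, 0 ≤ (2 * π * 2 ^ (j + 1) / Lr) ^ k
      * (Y * (Lr ^ 2 / (16 * c₀ * ((2 : ℝ) ^ j) ^ 2)) ^ (m + 1))
      * (if ∀ i, |t i| < 2 ^ (j + 1) / Lr then (1 : ℝ) else 0) := by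
    intro j
    apply mul_nonneg (by positivity)
    split_ifs <;> norm_num
  -- the momentum gap: `u = max_i |t_i| ≥ 1/L`
  obtain ⟨i₁, hi₁⟩ : ∃ i, 1 / Lr ≤ |t i| := by
    rcases hψ with h | h
    · exact ⟨0, inv_le_abs_addCharMomentum_of_index_ne_zero (hL 0) ψ h⟩
    · refine ⟨1, ?_⟩
      have h1 := inv_le_abs_addCharMomentum_of_index_ne_zero (hL 1) ψ h
      have hcast : ((Ls 1 : ℕ) : ℝ) = Lr := by rw [hLr, hL01]
      rw [hcast] at h1
      exact h1
  obtain ⟨i₀, -, hi₀⟩ := Finset.exists_max_image Finset.univ (fun i => |t i|) Finset.univ_nonempty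
  set u := |t i₀| with hu
  have hi₀' : ∀ i, |t i| ≤ u := fun i => hi₀ i (Finset.mem_univ i)
  have hτu : 1 / Lr ≤ u := hi₁.trans (hi₀' i₁)
  have hu_half : u ≤ 1 / 2 := abs_addCharMomentum_le (hL i₀) (he i₀) ψ
  have hLu1 : 1 ≤ Lr * u := by rw [div_le_iff₀ hLpos] at hτu; linarith
  set n₀ := ⌊Lr * u⌋₊ with hn₀
  have hn₀1 : 1 ≤ n₀ := Nat.le_floor (by exact_mod_cast hLu1)
  have hn₀le : (n₀ : ℝ) ≤ Lr * u := Nat.floor_le (by positivity)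
  have hn₀lt : Lr * u < n₀ + 1 := Nat.lt_floor_add_one _
  set j := Nat.log 2 n₀ with hj
  have hj1 : 2 ^ j ≤ n₀ := Nat.pow_log_le_self 2 (by omega)
  have hj2 : n₀ < 2 ^ (j + 1) := Nat.lt_pow_succ_log_self (by norm_num) n₀
  have hj1r : (2 : ℝ) ^ j ≤ Lr * u := le_trans (by exact_mod_cast hj1) hn₀le
  have hj2r : Lr * u < (2 : ℝ) ^ (j + 1) := by
    have : ((n₀ : ℝ) + 1) ≤ (2 : ℝ) ^ (j + 1) := by exact_mod_cast hj2
    linarith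
  -- the located shell index is `≤ log₂ L`
  have hjL : j < Nat.log 2 (Ls 0) + 1 := by
    have hn₀L : n₀ ≤ Ls 0 := by
      have h1 : (n₀ : ℝ) ≤ Lr := by
        calc (n₀ : ℝ) ≤ Lr * u := hn₀le
          _ ≤ Lr * (1 / 2) := by gcongr
          _ ≤ Lr := by linarith
      rw [hLr] at h1
      exact_mod_cast h1
    have := Nat.log_mono_right (b := 2) hn₀L
    omega
  have hushell : u < 2 ^ (j + 1) / Lr := by
    rw [lt_div_iff₀ hLpos]; linarith
  have hind : (∀ i, |t i| < 2 ^ (j + 1) / Lr) := fun i => (hi₀' i).trans_lt hushell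
  -- the lower bound on `a`
  have ha : 16 * c₀ * (2 ^ j) ^ 2 / Lr ^ 2 ≤ a := by
    have h1 : 16 * u ^ 2 ≤ 2 - 2 * (ψ (e i₀)).re := by
      have := sixteen_mul_sq_le (hL i₀) (he i₀) ψ
      rw [hu, sq_abs]
      exact this
    have h3 := hcoer ψ
    have hu2 : (2 ^ j) ^ 2 / Lr ^ 2 ≤ u ^ 2 := by
      rw [div_le_iff₀ (by positivity)]
      calc ((2 : ℝ) ^ j) ^ 2 ≤ (Lr * u) ^ 2 := by gcongr
        _ = u ^ 2 * Lr ^ 2 := by ring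
    calc 16 * c₀ * (2 ^ j) ^ 2 / Lr ^ 2 = c₀ * (16 * ((2 ^ j) ^ 2 / Lr ^ 2)) := by ring
      _ ≤ c₀ * (16 * u ^ 2) := by gcongr
      _ ≤ c₀ * (2 - 2 * (ψ (e i₀)).re) := by gcongr
      _ ≤ c₀ * ∑ i, (2 - 2 * (ψ (e i)).re) := by
          gcongr
          exact Finset.single_le_sum (fun i _ => two_sub_two_re_nonneg (hL i) (he i) ψ)
            (Finset.mem_univ i₀)
      _ ≤ a := h3
  have hlow : 0 < 16 * c₀ * (2 ^ j) ^ 2 / Lr ^ 2 := by positivity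
  -- `s ≤ Y · (L²/(16 c₀ 4^j))^{m+1}`
  have hsB : s ≤ Y * (Lr ^ 2 / (16 * c₀ * ((2 : ℝ) ^ j) ^ 2)) ^ (m + 1) := by
    have hapos : 0 < a := hlow.trans_le ha
    have h1 : s ≤ Y / a ^ (m + 1) := by
      rw [le_div_iff₀ (by positivity)]; exact hsY
    have h2 : Y / a ^ (m + 1) ≤ Y / (16 * c₀ * (2 ^ j) ^ 2 / Lr ^ 2) ^ (m + 1) := by
      gcongr
    have h3 : Y / (16 * c₀ * (2 ^ j) ^ 2 / Lr ^ 2) ^ (m + 1)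
        = Y * (Lr ^ 2 / (16 * c₀ * ((2 : ℝ) ^ j) ^ 2)) ^ (m + 1) := by
      rw [div_eq_mul_inv, ← inv_pow, inv_div]
    linarith
  -- the gradient factor on the shell
  have hPj : P ≤ (2 * π * 2 ^ (j + 1) / Lr) ^ k := by
    have := prod_norm_addChar_sub_one_le e Ls hL he ψ hi₀' l hl
    refine this.trans ?_
    rw [show 2 * π * 2 ^ (j + 1) / Lr = 2 * π * (2 ^ (j + 1) / Lr) by ring]
    gcongr
  have hmem : j ∈ Finset.range (Nat.log 2 (Ls 0) + 1) := Finset.mem_range.mpr hjL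
  calc P * s ≤ (2 * π * 2 ^ (j + 1) / Lr) ^ k * (Y * (Lr ^ 2 / (16 * c₀ * ((2 : ℝ) ^ j) ^ 2)) ^ (m + 1)) :=
        mul_le_mul hPj hsB hs0 (by positivity)
    _ = (2 * π * 2 ^ (j + 1) / Lr) ^ k * (Y * (Lr ^ 2 / (16 * c₀ * ((2 : ℝ) ^ j) ^ 2)) ^ (m + 1))
        * (if ∀ i, |t i| < 2 ^ (j + 1) / Lr then (1 : ℝ) else 0) := by rw [if_pos hind, mul_one]
    _ ≤ ∑ j ∈ Finset.range (Nat.log 2 (Ls 0) + 1), (2 * π * 2 ^ (j + 1) / Lr) ^ k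
        * (Y * (Lr ^ 2 / (16 * c₀ * ((2 : ℝ) ^ j) ^ 2)) ^ (m + 1))
        * (if ∀ i, |t i| < 2 ^ (j + 1) / Lr then (1 : ℝ) else 0) :=
      Finset.single_le_sum (fun j _ => hB0 j) hmem

omit [DecidableEq G] in
/-- **On the spatial zero modes a spatial difference vanishes**: if the indices of `ψ` along `e₀`
and `e₁` vanish and `l` contains one of `±e₀, ±e₁`, then `Π_{g∈l}‖ψ(g) − 1‖ = 0`. [folklore] -/
theorem prod_norm_addChar_sub_one_eq_zero_of_spatial
    (e : Fin 3 → G) (Ls : Fin 3 → ℕ) (hL : ∀ i, Ls i ≠ 0) (he : ∀ i, Ls i • e i = 0)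
    (ψ : AddChar G ℂ)
    (hψ : addCharIndex (Ls 0) (e 0) ψ = 0 ∧ addCharIndex (Ls 1) (e 1) ψ = 0)
    (l : List G) (hspat : ∃ g ∈ l, g = e 0 ∨ g = -e 0 ∨ g = e 1 ∨ g = -e 1) :
    (l.map fun g => ‖ψ g - 1‖).prod = 0 := by
  obtain ⟨g, hg, hg'⟩ := hspat
  have h0 : ψ (e 0) = 1 := addChar_apply_eq_one_of_index_eq_zero (hL 0) (he 0) ψ hψ.1
  have h1 : ψ (e 1) = 1 := addChar_apply_eq_one_of_index_eq_zero (hL 1) (he 1) ψ hψ.2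
  have hzero : ‖ψ g - 1‖ = 0 := by
    rcases hg' with rfl | rfl | rfl | rfl
    · simp [h0]
    · rw [norm_addChar_neg_sub_one]; simp [h0]
    · simp [h1]
    · rw [norm_addChar_neg_sub_one]; simp [h1]
  exact List.prod_eq_zero (List.mem_map.2 ⟨g, hg, hzero⟩)

/-- **On the spatial zero modes, a purely temporal difference obeys the one-dimensional
cube/shell domination at scale `2^{−N}`** (indicators of `{idx₀ = idx₁ = 0, |t₂| < ρ}`).
[folklore] -/
theorem gradSymbol_frdPiecePow_le_shells_zeroMode
    (e : Fin 3 → G) (Ls : Fin 3 → ℕ) (hL : ∀ i, Ls i ≠ 0) (he : ∀ i, Ls i • e i = 0)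
    (hA : IsTranslationInvariant A) (hs : A.IsHermitian) (h0 : A.PosSemidef)
    (h4 : ((4 : ℝ) • (1 : _root_.Matrix G G ℝ) - A).PosSemidef)
    {c₀ : ℝ} (hc₀ : 0 < c₀)
    (hcoer : ∀ ψ : AddChar G ℂ, c₀ * ∑ i, (2 - 2 * (ψ (e i)).re) ≤ (symbol A ψ).re)
    (m N : ℕ) (ψ : AddChar G ℂ)
    (hψ : addCharIndex (Ls 0) (e 0) ψ = 0 ∧ addCharIndex (Ls 1) (e 1) ψ = 0)
    (l : List G) (htemp : ∀ g ∈ l, g = e 2 ∨ g = -e 2) :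
    (l.map fun g => ‖ψ g - 1‖).prod * (symbol (frdPiecePow A m N) ψ).re
      ≤ (2 * π / 2 ^ N) ^ l.length * (m * ((2 : ℝ) ^ N) ^ 2 / 4)
          * (if |addCharMomentum (Ls 2) (e 2) ψ| < 1 / 2 ^ N then (1 : ℝ) else 0)
        + ∑ j ∈ Finset.range N, (2 * π * 2 ^ (j + 1) / 2 ^ N) ^ l.length
            * (m * π ^ (2 * m + 2) / (4 * ((2 : ℝ) ^ N) ^ (2 * m))
              * (((2 : ℝ) ^ N) ^ 2 / (16 * c₀ * ((2 : ℝ) ^ j) ^ 2)) ^ (m + 1))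
            * (if |addCharMomentum (Ls 2) (e 2) ψ| < 2 ^ (j + 1) / 2 ^ N then (1 : ℝ) else 0) := by
  set T : ℝ := 2 ^ N with hT
  have hTpos : 0 < T := by positivity
  set t : Fin 3 → ℝ := fun i => addCharMomentum (Ls i) (e i) ψ with ht
  set s := (symbol (frdPiecePow A m N) ψ).re with hsdef
  set a := (symbol A ψ).re with hadef
  set k := l.length with hk
  set P := (l.map fun g => ‖ψ g - 1‖).prod with hPdef
  set Y : ℝ := m * π ^ (2 * m + 2) / (4 * T ^ (2 * m)) with hYdef
  have hY0 : 0 ≤ Y := by rw [hYdef]; positivity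
  have hP0 : 0 ≤ P := List.prod_nonneg fun x hx => by
    obtain ⟨g', -, rfl⟩ := List.mem_map.mp hx
    exact norm_nonneg _
  have hs0 : 0 ≤ s := symbol_frdPiecePow_re_nonneg ψ hA hs h0 h4 m N
  have hsX : s ≤ m * T ^ 2 / 4 := by
    have := symbol_frdPiecePow_re_le ψ hA hs h0 h4 m N
    rwa [four_pow_eq''] at this
  have hsY : s * a ^ (m + 1) ≤ Y := by
    have := symbol_frdPiecePow_re_mul_pow_le ψ hA hs h0 h4 m N
    rwa [four_pow_mul_eq'] at this
  -- the spatial momenta vanish, so `u := |t₂|` bounds all momenta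
  set u := |t 2| with hu
  have ht0 : t 0 = 0 := addCharMomentum_eq_zero_of_index_eq_zero ψ hψ.1
  have ht1 : t 1 = 0 := addCharMomentum_eq_zero_of_index_eq_zero ψ hψ.2
  have hi₀' : ∀ i, |t i| ≤ u := by
    intro i
    fin_cases i
    · simp [ht0, hu]
    · simp [ht1, hu]
    · exact le_rfl
  have hl : ∀ g ∈ l, ∃ i, g = e i ∨ g = -e i := fun g hg => ⟨2, htemp g hg⟩
  have hB0 : ∀ j, 0 ≤ (2 * π * 2 ^ (j + 1) / T) ^ k
      * (Y * (T ^ 2 / (16 * c₀ * ((2 : ℝ) ^ j) ^ 2)) ^ (m + 1))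
      * (if |t 2| < 2 ^ (j + 1) / T then (1 : ℝ) else 0) := by
    intro j
    apply mul_nonneg (by positivity)
    split_ifs <;> norm_num
  have hsum0 : 0 ≤ ∑ j ∈ Finset.range N, (2 * π * 2 ^ (j + 1) / T) ^ k
      * (Y * (T ^ 2 / (16 * c₀ * ((2 : ℝ) ^ j) ^ 2)) ^ (m + 1))
      * (if |t 2| < 2 ^ (j + 1) / T then (1 : ℝ) else 0) :=
    Finset.sum_nonneg fun j _ => hB0 j
  by_cases hcube : |t 2| < 1 / T
  · rw [if_pos hcube, mul_one]
    have hPc : P ≤ (2 * π / T) ^ k := by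
      have := prod_norm_addChar_sub_one_le e Ls hL he ψ (u := 1 / T)
        (fun i => (hi₀' i).trans hcube.le) l hl
      rwa [show 2 * π * (1 / T) = 2 * π / T by ring] at this
    have h1 : P * s ≤ (2 * π / T) ^ k * (m * T ^ 2 / 4) := mul_le_mul hPc hsX hs0 (by positivity)
    linarith
  -- outside the small cube: the dyadic shell of `u = |t₂| ≥ 1/T`
  rw [if_neg hcube, mul_zero, zero_add]
  have hτu : 1 / T ≤ u := le_of_not_gt hcube
  have hu_half : u ≤ 1 / 2 := abs_addCharMomentum_le (hL 2) (he 2) ψ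
  have hTu1 : 1 ≤ T * u := by rw [div_le_iff₀ hTpos] at hτu; linarith
  set n₀ := ⌊T * u⌋₊ with hn₀
  have hn₀1 : 1 ≤ n₀ := Nat.le_floor (by exact_mod_cast hTu1)
  have hn₀le : (n₀ : ℝ) ≤ T * u := Nat.floor_le (by positivity)
  have hn₀lt : T * u < n₀ + 1 := Nat.lt_floor_add_one _
  set j := Nat.log 2 n₀ with hj
  have hj1 : 2 ^ j ≤ n₀ := Nat.pow_log_le_self 2 (by omega)
  have hj2 : n₀ < 2 ^ (j + 1) := Nat.lt_pow_succ_log_self (by norm_num) n₀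
  have hj1r : (2 : ℝ) ^ j ≤ T * u := le_trans (by exact_mod_cast hj1) hn₀le
  have hj2r : T * u < (2 : ℝ) ^ (j + 1) := by
    have : ((n₀ : ℝ) + 1) ≤ (2 : ℝ) ^ (j + 1) := by exact_mod_cast hj2
    linarith
  have hjN : j < N := by
    have h1 : (2 : ℝ) ^ j < 2 ^ N := by
      calc (2 : ℝ) ^ j ≤ T * u := hj1r
        _ ≤ T * (1 / 2) := by gcongr
        _ < T := by linarith
        _ = 2 ^ N := hT
    exact (pow_lt_pow_iff_right₀ (by norm_num : (1 : ℝ) < 2)).mp h1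
  have hushell : u < 2 ^ (j + 1) / T := by
    rw [lt_div_iff₀ hTpos]; linarith
  have hind : |t 2| < 2 ^ (j + 1) / T := hushell
  -- the lower bound on `a` from the temporal direction
  have ha : 16 * c₀ * (2 ^ j) ^ 2 / T ^ 2 ≤ a := by
    have h1 : 16 * u ^ 2 ≤ 2 - 2 * (ψ (e 2)).re := by
      have := sixteen_mul_sq_le (hL 2) (he 2) ψ
      rw [hu, sq_abs]
      exact this
    have h3 := hcoer ψ
    have hu2 : (2 ^ j) ^ 2 / T ^ 2 ≤ u ^ 2 := by
      rw [div_le_iff₀ (by positivity)]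
      calc ((2 : ℝ) ^ j) ^ 2 ≤ (T * u) ^ 2 := by gcongr
        _ = u ^ 2 * T ^ 2 := by ring
    calc 16 * c₀ * (2 ^ j) ^ 2 / T ^ 2 = c₀ * (16 * ((2 ^ j) ^ 2 / T ^ 2)) := by ring
      _ ≤ c₀ * (16 * u ^ 2) := by gcongr
      _ ≤ c₀ * (2 - 2 * (ψ (e 2)).re) := by gcongr
      _ ≤ c₀ * ∑ i, (2 - 2 * (ψ (e i)).re) := by
          gcongr
          exact Finset.single_le_sum (fun i _ => two_sub_two_re_nonneg (hL i) (he i) ψ)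
            (Finset.mem_univ (2 : Fin 3))
      _ ≤ a := h3
  have hlow : 0 < 16 * c₀ * (2 ^ j) ^ 2 / T ^ 2 := by positivity
  have hsB : s ≤ Y * (T ^ 2 / (16 * c₀ * ((2 : ℝ) ^ j) ^ 2)) ^ (m + 1) := by
    have hapos : 0 < a := hlow.trans_le ha
    have h1 : s ≤ Y / a ^ (m + 1) := by
      rw [le_div_iff₀ (by positivity)]; exact hsY
    have h2 : Y / a ^ (m + 1) ≤ Y / (16 * c₀ * (2 ^ j) ^ 2 / T ^ 2) ^ (m + 1) := by
      gcongr
    have h3 : Y / (16 * c₀ * (2 ^ j) ^ 2 / T ^ 2) ^ (m + 1)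
        = Y * (T ^ 2 / (16 * c₀ * ((2 : ℝ) ^ j) ^ 2)) ^ (m + 1) := by
      rw [div_eq_mul_inv, ← inv_pow, inv_div]
    linarith
  have hPj : P ≤ (2 * π * 2 ^ (j + 1) / T) ^ k := by
    have := prod_norm_addChar_sub_one_le e Ls hL he ψ hi₀' l hl
    refine this.trans ?_
    rw [show 2 * π * 2 ^ (j + 1) / T = 2 * π * (2 ^ (j + 1) / T) by ring]
    gcongr
  have hmem : j ∈ Finset.range N := Finset.mem_range.mpr hjN
  calc P * s ≤ (2 * π * 2 ^ (j + 1) / T) ^ k * (Y * (T ^ 2 / (16 * c₀ * ((2 : ℝ) ^ j) ^ 2)) ^ (m + 1)) :=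
        mul_le_mul hPj hsB hs0 (by positivity)
    _ = (2 * π * 2 ^ (j + 1) / T) ^ k * (Y * (T ^ 2 / (16 * c₀ * ((2 : ℝ) ^ j) ^ 2)) ^ (m + 1))
        * (if |t 2| < 2 ^ (j + 1) / T then (1 : ℝ) else 0) := by rw [if_pos hind, mul_one]
    _ ≤ ∑ j ∈ Finset.range N, (2 * π * 2 ^ (j + 1) / T) ^ k
        * (Y * (T ^ 2 / (16 * c₀ * ((2 : ℝ) ^ j) ^ 2)) ^ (m + 1))
        * (if |t 2| < 2 ^ (j + 1) / T then (1 : ℝ) else 0) :=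
      Finset.single_le_sum (fun j _ => hB0 j) hmem

end Shells

end Literature.Analysis.Matrix
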